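import Mathlib
import Literature.Computability.AlgebraicComplexity.LowDepthRankBound
import Literature.Computability.AlgebraicComplexity.WordPolynomialRank
import Literature.Computability.Complexity.ConstantDepthIMMProofs
import Literature.ModelTheory.FiniteModelTheory.SymmetricCircuitCountingWidthProofs
import Summits.ValiantsHypothesis.ValiantsHypothesis.Theorems.BarrierLeverDefinableEquationsBlockPlacement

/-!
# Route BarrierLever — the MODEL axis of crux `DefinableEquations` (stmt-8745) / item
# `SingleSizeEquations` (stmt-8749): NATURAL PROOFS AGAINST CONSTANT PRODUCT-DEPTH CIRCUITS OF EVERY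
# POLYNOMIAL SIZE (Limaye–Srinivasan–Tavenas made FSV-natural; val-np-p5 g8)

**Theorem (`naturalProofsAgainstProductDepth`).**  For every size exponent `b` and every
product-depth `Δ ≥ 1` there are `a, n₀` such that for all `n ≥ n₀` the `n`-variate polynomials of
degree `≤ n` computed by arithmetic circuits (unbounded fan-in) with `≤ n^b` gates and
product-depth `≤ Δ` are NOT a succinct hitting set for `Distinguishers ℂ n a` (FSV Def. 3): an
explicit polynomial of size and degree `≤ C(2n,n)^a` in the coefficient variables is nonzero and
vanishes on all of them; `productDepthSliceEquations` is the `q = 0` Boolean-sum shape the crux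
asks for, `naturalProofsAgainstProductDepth_smallCircuits` the fan-in-two sub-slice of
`SmallCircuits ℂ n b`.  After g3–g4's slices (formulas `≤ n²/20`, `ΣΛΣ`, homogeneous `ΣΠΣ`,
ROABPs) the model axis now covers the strongest known constant-depth lower-bound method, at
every polynomial size.

**Proof.**  Everything heavy is the tree's LST development (Literature, proved there):
the semantic Claim 16 / Lemma 15 `LSTWord.relRank_aeval_eval_le` — for a circuit `P` on `x_1..x_n`
of product-depth `≤ Δ` and a block-preserving substitution `g`, the relative rank of the
`d`-block set-multilinear coefficient matrix of `g(P)` is `≤ Λ_Δ(|P|, n, d) · Φ_Δ(k, d)` — and the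
arithmetic `LSTWord.final_arith` (LST Cor. 4: `2^{-k/2} ≤ Λ Φ` forces `n^{d^δ} ≤ s`).  Here:
§1 `pdRank_lt_of_relRank_lt` — `relRank < 2^{-|w_{[d]}|/2}` is `pdRank < min(#rows, #cols)`
(the normalisation of `LSTWord.relRank_wordPoly`); §2 `relRank_killCompl_le` — the engine applied
to `g = killCompl e` (rename the embedded block variables, kill the rest;
`BlockPlacement.isBlockPreserving_killCompl`), `Lam_mono`; §3 `not_isSuccinctHittingSet_productDepth`
— the POINTWISE slice theorem with the numeric hypothesis `Λ_Δ(s,n,d) Φ_Δ(k,d) < 2^{-k/2}`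
explicit, via `BlockPlacement.not_isSuccinctHittingSet_of_pdRank_lt` and
`RankTemplate.isNaturalProof_det` (the distinguisher is the coordinate determinant of a
`2^{min(|σ⁺|,|σ⁻|)}`-square block of the coefficient matrix — nonzero for free); §4 bookkeeping
(`letterSize ≤ k`, `streamLen ≤ d k`, `#block variables ≤ d 2^k`, `8(n^d+1)^7 ≤ C(2n,n)^{7d+10}`,
the choice `d ≥ (b+1)^{1/δ}`); §5 the asymptotic assembly: `d = max(d₀, ⌈(b+1)^{1/δ}⌉)`,
`2^c > d`, `k = ⌊log₂ n⌋ - c` (so the `≤ d 2^k` block variables of the greedy `k`-unbiased word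
on `d` blocks embed among `x_1..x_n`), the side conditions of `final_arith`
(`d ≤ ε(k+1)`, `10d ≤ k`, `n+1 ≤ 2^{6k}`, `√n ≤ 2^k`) for `n ≥ 2^M + d`, and the contrapositive
of `final_arith`: `n^b < n^{b+1} ≤ n^{d^δ}` forbids `2^{-k/2} ≤ Λ Φ`.  Level `a = 7d + 10`.

What this is NOT: constant product-depth only — nothing on general size-`n^b` circuits (the crux;
b = 2 OPEN, Chatterjee–Tengse §1.3 dir. 2) and nothing on `VP ≠ VNP`; the lower-bound CONTENT is
LST's theorem, already kernel-checked in the tree; this file is its FSV-natural packaging in the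
crux's regime `d = n`.  No definitions, no named facts; standard axioms.
Refs: Limaye–Srinivasan–Tavenas, J. ACM 72 (2025) Art. 26 (= FOCS 2021), Lemma 15, Claim 16,
Cor. 4; Forbes–Shpilka–Volk 2018 Def. 1/3, Thm. 4.
-/

-- `Summit.ValiantsHypothesis.ValiantsHypothesis.…` repeats a component by the D-0017 layout
-- (single-conjunct summit), which the `dupNamespace` linter flags; the name is mandated.
set_option linter.dupNamespace false

noncomputable section

namespace Summit.ValiantsHypothesis.ValiantsHypothesis.Theorems.BarrierLeverDefinableEquations

open MvPolynomial
open Literature.Computability.AlgebraicComplexity Literature.Barriers.ValiantsHypothesis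
open Literature.Computability.AlgebraicComplexity.LSTWord
open scoped BigOperators

namespace LSTSlice

variable {d : ℕ} (k : ℕ) (pos : Fin d → Bool)

/-! ## §1 Normalisation: `relRank < 2^{-|w_{[d]}|/2}` means `pdRank < min(#rows, #cols)` -/

/-- The number `min(#rows, #cols) = 2^{min(|σ⁺|, |σ⁻|)}` of the LST coefficient matrix and its
relative form: `min(#rows, #cols) / √(#rows · #cols) = 2^{-|w_{[d]}|/2}`; hence a polynomial on
the word blocks with `relRank < 2^{-|w_{[d]}|/2}` has `pdRank < 2^{min(|σ⁺|, |σ⁻|)}`.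
[cite: LimayeSrinivasanTavenas2025, §2.1–2.2] -/
theorem pdRank_lt_of_relRank_lt (F : MvPolynomial (Σ i, BlockVar k pos i) ℂ)
    (h : relRank ℂ pos Finset.univ F < (2 : ℝ) ^ (-(overLen k pos d : ℝ) / 2)) :
    pdRank ℂ (posBlocks pos) (negBlocks pos) F <
      2 ^ min (streamLen k pos true d) (streamLen k pos false d) := by
  -- the same computation as `LSTWord.relRank_wordPoly`, with `pdRank F` in place of `2^min`
  unfold relRank relRankPair at h
  have hR : (∏ i ∈ posBlocks pos, (Fintype.card (BlockVar k pos i) : ℝ)) =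
      (2 : ℝ) ^ (streamLen k pos true d : ℝ) := by
    rw [Real.rpow_natCast]; exact_mod_cast prod_card_posBlocks k pos
  have hC : (∏ i ∈ negBlocks pos, (Fintype.card (BlockVar k pos i) : ℝ)) =
      (2 : ℝ) ^ (streamLen k pos false d : ℝ) := by
    rw [Real.rpow_natCast]; exact_mod_cast prod_card_negBlocks k pos
  change (pdRank ℂ (posBlocks pos) (negBlocks pos) F : ℝ) /
      Real.sqrt ((∏ i ∈ posBlocks pos, (Fintype.card (BlockVar k pos i) : ℝ)) *
        ∏ i ∈ negBlocks pos, (Fintype.card (BlockVar k pos i) : ℝ)) < _ at h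
  rw [hR, hC, ← Real.rpow_add (by norm_num : (0 : ℝ) < 2), Real.sqrt_eq_rpow, ← Real.rpow_mul
    (by norm_num : (0 : ℝ) ≤ 2), div_lt_iff₀ (by positivity), ← Real.rpow_add (by norm_num)] at h
  -- the exponent on the right is `min(sT, sF)`
  set sT := streamLen k pos true d with hsT
  set sF := streamLen k pos false d with hsF
  have hexp : -(overLen k pos d : ℝ) / 2 + ((sT : ℝ) + sF) * (1 / 2) = (min sT sF : ℕ) := by
    rw [overLen_d_eq, Nat.cast_min]
    by_cases hle : sT ≤ sF
    · rw [min_eq_left (by exact_mod_cast hle), Nat.sub_eq_zero_of_le hle, zero_add,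
        Nat.cast_sub hle]; ring
    · push Not at hle
      rw [min_eq_right (by exact_mod_cast hle.le), Nat.sub_eq_zero_of_le hle.le, add_zero,
        Nat.cast_sub hle.le]; ring
  rw [hexp, Real.rpow_natCast] at h
  exact_mod_cast h

/-! ## §2 The engine on a renamed small circuit -/

/-- `Λ` is monotone in the size parameter. [folklore] -/
theorem Lam_mono {s s' : ℕ} (h : s ≤ s') (N dd p : ℕ) : Lam s N dd p ≤ Lam s' N dd p := by
  rw [Lam_eq, Lam_eq]
  have hnat : stepConst s N dd ≤ stepConst s' N dd := by
    unfold stepConst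
    have h1 : (s + 1) * (s + N + 1) ≤ (s' + 1) * (s' + N + 1) :=
      Nat.mul_le_mul (by omega) (by omega)
    have h2 := Nat.mul_le_mul_right ((dd + 1) ^ (5 * dd + 1)) h1
    omega
  have hstep : (stepConst s N dd : ℝ) ≤ stepConst s' N dd := by exact_mod_cast hnat
  exact mul_le_mul_of_nonneg_right (pow_le_pow_left₀ (by positivity) hstep _) (by positivity)

/-- **The LST engine applied to a small low-product-depth circuit, read through the renaming
`killCompl e`.**  If `f` is computed by a circuit `P` on `x_1..x_n` with `≤ s` gates and
product-depth `≤ Δ`, `e` embeds the word blocks among the `x_v`, `10 d ≤ k`, `1 ≤ d`, then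
`relRank(killCompl e f) ≤ Λ_Δ(s, n, d) · Φ_Δ(k, d)`. [cite: LimayeSrinivasanTavenas2025, Lemma 15] -/
theorem relRank_killCompl_le {n s Δ : ℕ} (hd : 1 ≤ d) (hk : 10 * d ≤ k)
    (e : (Σ i, BlockVar k pos i) ↪ Fin n) {f : MvPolynomial (Fin n) ℂ} {P : ArithCircuit ℂ (Fin n)}
    (hPf : P.Computes f) (hPs : P.size ≤ s) (hPΔ : P.productDepth ≤ Δ) :
    relRank ℂ pos Finset.univ (killCompl e.injective f) ≤ Lam s n d Δ * Phi k Δ d := by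
  have i₀ : Fin d := ⟨0, hd⟩
  rw [BlockPlacement.killCompl_eq_aeval, show f = P.eval from hPf.symm]
  refine (relRank_aeval_eval_le (BlockPlacement.isBlockPreserving_killCompl e i₀) hk hd hPΔ).trans ?_
  rw [Fintype.card_fin]
  exact mul_le_mul_of_nonneg_right (Lam_mono hPs n d Δ) (Phi_pos k Δ d).le

/-! ## §3 The slice theorem, with the numeric hypothesis explicit -/

/-- **Natural proofs against product-depth-`Δ` circuits of size `s` — pointwise form.**  Data: a
word `pos : Fin d → Bool` with `|w_{[d]}| ≤ k`, `10 d ≤ k`, `1 ≤ d ≤ n`, an embedding `e` of its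
`Σ_i 2^{|w_i|}` block variables among `x_1, …, x_n`, and the NUMERIC HYPOTHESIS
`Λ_Δ(s, n, d) · Φ_Δ(k, d) < 2^{-k/2}` (which `LSTWord.final_arith` supplies for `s < n^{d^δ}`,
`d ≤ ε log n`).  Conclusion: the class of `n`-variate polynomials of degree `≤ n` computed by a
circuit with `≤ s` gates (any fan-in) and product-depth `≤ Δ` is NOT a succinct hitting set for
`Distinguishers ℂ n a`, `8(2^{min(|σ⁺|,|σ⁻|)}+1)^7 ≤ C(2n,n)^a` — the coordinate determinant of
an `r × r` block of the LST coefficient matrix (`r = min(#rows, #cols)`) is the natural proof.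
[cite: LimayeSrinivasanTavenas2025, Lemma 15 and Cor. 4] -/
theorem not_isSuccinctHittingSet_productDepth {n s Δ a : ℕ} (hd : 1 ≤ d) (hdn : d ≤ n)
    (hk : 10 * d ≤ k) (hover : overLen k pos d ≤ k) (e : (Σ i, BlockVar k pos i) ↪ Fin n)
    (hnum : Lam s n d Δ * Phi k Δ d < (2 : ℝ) ^ (-(k : ℝ) / 2))
    (ha : 8 * (2 ^ min (streamLen k pos true d) (streamLen k pos false d) + 1) ^ 7 ≤
      Nat.choose (2 * n) n ^ a) :
    ¬ IsSuccinctHittingSet (degLEMonomials n)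
        {f : MvPolynomial (Fin n) ℂ | f.totalDegree ≤ n ∧
          ∃ P : ArithCircuit ℂ (Fin n), P.Computes f ∧ P.size ≤ s ∧ P.productDepth ≤ Δ}
        (Distinguishers ℂ n a) := by
  classical
  have hAB : Disjoint (posBlocks pos) (negBlocks pos) := by
    rw [Finset.disjoint_filter]; intro i _ hi; simpa using hi
  have hcard : (posBlocks pos).card + (negBlocks pos).card ≤ n := by
    rw [← Finset.card_union_of_disjoint hAB]
    exact (Finset.card_le_univ _).trans (by rw [Fintype.card_fin]; exact hdn)
  refine BlockPlacement.not_isSuccinctHittingSet_of_pdRank_lt e hAB hcard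
    (r := 2 ^ min (streamLen k pos true d) (streamLen k pos false d)) ?_ ?_ (fun f hf => ?_) ha
  · rw [card_rows]; exact Nat.pow_le_pow_right (by norm_num) (min_le_left _ _)
  · rw [card_cols]; exact Nat.pow_le_pow_right (by norm_num) (min_le_right _ _)
  · obtain ⟨-, P, hPf, hPs, hPΔ⟩ := hf
    refine pdRank_lt_of_relRank_lt k pos _ (lt_of_le_of_lt (relRank_killCompl_le k pos hd hk e hPf hPs hPΔ)
      (hnum.trans_le ?_))
    exact Real.rpow_le_rpow_of_exponent_le (by norm_num) (by
      have : (overLen k pos d : ℝ) ≤ k := by exact_mod_cast hover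
      linarith)

/-! ## §4 Bookkeeping for the asymptotic form -/

/-- Every letter has size `≤ k`. [folklore] -/
theorem letterSize_le (i : Fin d) : letterSize k pos i ≤ k := by
  unfold letterSize
  split_ifs
  · exact posLetter_le k
  · exact le_rfl

/-- The streams have length `≤ d k`. [folklore] -/
theorem streamLen_le (sgn : Bool) : ∀ t : ℕ, streamLen k pos sgn t ≤ t * k
  | 0 => by simp [streamLen]
  | t + 1 => by
    rw [streamLen]
    have ih := streamLen_le sgn t
    have h2 : (if h : t < d then (if pos ⟨t, h⟩ = sgn then letterSize k pos ⟨t, h⟩ else 0) else 0) ≤ k := by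
      split_ifs
      · exact letterSize_le k pos _
      · exact Nat.zero_le _
      · exact Nat.zero_le _
    calc streamLen k pos sgn t + _ ≤ t * k + k := Nat.add_le_add ih h2
      _ = (t + 1) * k := by ring

/-- The word has `≤ d · 2^k` block variables. [folklore] -/
theorem card_blockVars_le : Fintype.card (Σ i : Fin d, BlockVar k pos i) ≤ d * 2 ^ k := by
  rw [Fintype.card_sigma]
  calc ∑ i, Fintype.card (BlockVar k pos i) ≤ ∑ _i : Fin d, 2 ^ k := by
        refine Finset.sum_le_sum fun i _ => ?_
        rw [card_blockVar]
        exact Nat.pow_le_pow_right (by norm_num) (letterSize_le k pos i)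
    _ = d * 2 ^ k := by simp

/-- Level arithmetic: `8 (n^d + 1)^7 ≤ C(2n,n)^(7d + 10)` for `n ≥ 1`. [folklore] -/
theorem level_le {n dd : ℕ} (hn : 1 ≤ n) :
    8 * (n ^ dd + 1) ^ 7 ≤ Nat.choose (2 * n) n ^ (7 * dd + 10) := by
  set N := Nat.choose (2 * n) n with hN
  have h2N : 2 ^ n ≤ N := Literature.ModelTheory.FiniteModelTheory.two_pow_le_choose_two_mul_self n
  have hnN : n ≤ N := (Nat.lt_two_pow_self).le.trans h2N
  have h2 : 2 ≤ N := le_trans (by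
    calc (2 : ℕ) = 2 ^ 1 := by norm_num
      _ ≤ 2 ^ n := Nat.pow_le_pow_right (by norm_num) hn) h2N
  have h1 : n ^ dd + 1 ≤ 2 * N ^ dd := by
    have := Nat.pow_le_pow_left hnN dd
    have h1' : 1 ≤ N ^ dd := Nat.one_le_pow _ _ (by omega)
    omega
  calc 8 * (n ^ dd + 1) ^ 7 ≤ 8 * (2 * N ^ dd) ^ 7 := by gcongr
    _ = 2 ^ 10 * N ^ (7 * dd) := by ring
    _ ≤ N ^ 10 * N ^ (7 * dd) := Nat.mul_le_mul_right _ (Nat.pow_le_pow_left h2 10)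
    _ = N ^ (7 * dd + 10) := by ring

/-- Choice of `d`: for `d ≥ ⌈(b+1)^{1/δ}⌉₊` one has `b + 1 ≤ d^δ`. [folklore] -/
theorem rpow_ge_of_ceil_le {b dd : ℕ} {δ : ℝ} (hδ : 0 < δ)
    (h : ⌈((b : ℝ) + 1) ^ (1 / δ)⌉₊ ≤ dd) : (b : ℝ) + 1 ≤ (dd : ℝ) ^ δ := by
  have h0 : (0 : ℝ) ≤ (b : ℝ) + 1 := by positivity
  have h1 : ((b : ℝ) + 1) ^ (1 / δ) ≤ dd := (Nat.le_ceil _).trans (by exact_mod_cast h)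
  calc (b : ℝ) + 1 = (((b : ℝ) + 1) ^ (1 / δ)) ^ δ := by
        rw [← Real.rpow_mul h0, one_div_mul_cancel hδ.ne', Real.rpow_one]
    _ ≤ (dd : ℝ) ^ δ := Real.rpow_le_rpow (by positivity) h1 hδ.le

/-! ## §5 The slice at every size exponent: natural proofs against constant product-depth -/

/-- **NATURAL PROOFS AGAINST CONSTANT PRODUCT-DEPTH CIRCUITS OF EVERY POLYNOMIAL SIZE**
(Limaye–Srinivasan–Tavenas 2021/2025 made FSV-natural, regime `d = n`).  For every size exponent
`b` and product-depth `Δ ≥ 1` there are a level `a` and a threshold `n₀` such that for all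
`n ≥ n₀` the `n`-variate polynomials of degree `≤ n` computed by arithmetic circuits (unbounded
fan-in) with at most `n^b` gates and product-depth at most `Δ` are NOT a succinct hitting set for
`Distinguishers ℂ n a`: an explicit `poly(N)`-size, `poly(N)`-degree polynomial in the
`N = C(2n,n)` coefficient variables — a coordinate determinant of the LST relative-rank matrix of
the word-renamed polynomial — is nonzero and vanishes on all of them.  Ingredients: the tree's
LST engine `LSTWord.relRank_aeval_eval_le` and arithmetic `LSTWord.final_arith`, the greedy
`k`-unbiased word, `RankTemplate`, `BlockPlacement`.  (`Δ = 0` is contained in `Δ = 1`.)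
WHAT THIS IS NOT: constant product-depth only; nothing on general size-`n^b` circuits (the crux,
b = 2 OPEN) or on `VP ≠ VNP`. [cite: LimayeSrinivasanTavenas2025, Cor. 4] -/
theorem naturalProofsAgainstProductDepth (b Δ : ℕ) (hΔ : 1 ≤ Δ) :
    ∃ a n₀ : ℕ, ∀ n ≥ n₀, ¬ IsSuccinctHittingSet (degLEMonomials n)
      {f : MvPolynomial (Fin n) ℂ | f.totalDegree ≤ n ∧
        ∃ P : ArithCircuit ℂ (Fin n), P.Computes f ∧ P.size ≤ n ^ b ∧ P.productDepth ≤ Δ}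
      (Distinguishers ℂ n a) := by
  obtain ⟨δ, hδ, ε, hε, -, d₀, hd₀, H⟩ := final_arith (Δ := Δ) hΔ
  -- the number of blocks `d`: `d₀ ≤ d` and `b + 1 ≤ d^δ`
  obtain ⟨d, hd₀d, hbδ⟩ : ∃ d : ℕ, d₀ ≤ d ∧ (b : ℝ) + 1 ≤ (d : ℝ) ^ δ :=
    ⟨max d₀ ⌈((b : ℝ) + 1) ^ (1 / δ)⌉₊, le_max_left _ _,
      rpow_ge_of_ceil_le hδ (le_max_right _ _)⟩
  have hd1 : 1 ≤ d := hd₀.trans hd₀d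
  -- a shift `c` with `d < 2^c`
  obtain ⟨c, hdc⟩ : ∃ c : ℕ, d < 2 ^ c := ⟨Nat.log 2 d + 1, Nat.lt_pow_succ_log_self one_lt_two d⟩
  -- threshold
  set M : ℕ := ⌈(d : ℝ) / ε⌉₊ + 10 * d + 6 * c + 10 with hM
  refine ⟨7 * d + 10, 2 ^ M + d, fun n hn => ?_⟩
  have hnM : 2 ^ M ≤ n := le_trans (Nat.le_add_right _ _) hn
  have hdn : d ≤ n := le_trans (Nat.le_add_left _ _) hn
  have hn1 : 1 ≤ n := hd1.trans hdn
  have hMpos : 1 ≤ M := by omega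
  have hn2 : 2 ≤ n := le_trans (by
    calc (2 : ℕ) = 2 ^ 1 := by norm_num
      _ ≤ 2 ^ M := Nat.pow_le_pow_right (by norm_num) hMpos) hnM
  -- `K = ⌊log₂ n⌋`, `k = K - c`
  set K := Nat.log 2 n with hK
  have hMK : M ≤ K := Nat.le_log_of_pow_le one_lt_two hnM
  have h2K : 2 ^ K ≤ n := Nat.pow_log_le_self 2 (by omega)
  have hn2K : n < 2 ^ (K + 1) := Nat.lt_pow_succ_log_self one_lt_two n
  obtain ⟨k, hkK⟩ : ∃ k, K = k + c := ⟨K - c, by omega⟩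
  have hceil : ⌈(d : ℝ) / ε⌉₊ ≤ k := by omega
  have h10 : 10 * d ≤ k := by omega
  have hk1 : 1 ≤ k := by omega
  have hck : c + 1 ≤ k := by omega
  -- the greedy `k`-unbiased word on `d` blocks
  set pos := greedyWord d k with hpos
  have hover : overLen k pos d ≤ k := by
    rw [overLen_eq_natAbs k pos d le_rfl]
    have h := abs_prefixSum_greedyWord_le d k d le_rfl
    rw [← hpos, abs_le] at h
    omega
  -- the embedding of the `≤ d 2^k ≤ 2^K ≤ n` block variables among `x_1, …, x_n`
  have hcardle : Fintype.card (Σ i : Fin d, BlockVar k pos i) ≤ n := by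
    refine (card_blockVars_le k pos).trans ?_
    calc d * 2 ^ k ≤ 2 ^ c * 2 ^ k := Nat.mul_le_mul_right _ hdc.le
      _ = 2 ^ K := by rw [← pow_add, add_comm, hkK]
      _ ≤ n := h2K
  let e : (Σ i : Fin d, BlockVar k pos i) ↪ Fin n :=
    (Fintype.equivFin _).toEmbedding.trans (Fin.castLEEmb hcardle)
  -- the level: `8 (2^min + 1)^7 ≤ 8 (n^d + 1)^7 ≤ N^(7d+10)`
  have h2k_le_n : 2 ^ k ≤ n := le_trans (Nat.pow_le_pow_right (by norm_num) (by omega)) h2K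
  have ha : 8 * (2 ^ min (streamLen k pos true d) (streamLen k pos false d) + 1) ^ 7 ≤
      Nat.choose (2 * n) n ^ (7 * d + 10) := by
    refine le_trans ?_ (level_le (dd := d) hn1)
    have hmin : 2 ^ min (streamLen k pos true d) (streamLen k pos false d) ≤ n ^ d := by
      calc 2 ^ min (streamLen k pos true d) (streamLen k pos false d) ≤ 2 ^ (d * k) :=
            Nat.pow_le_pow_right (by norm_num) ((min_le_left _ _).trans (streamLen_le k pos true d))
        _ = (2 ^ k) ^ d := by rw [← pow_mul, mul_comm]
        _ ≤ n ^ d := Nat.pow_le_pow_left h2k_le_n d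
    gcongr
  -- the numeric hypothesis, from `final_arith` (contrapositive: `n^b < n^{d^δ}`)
  have hnR2 : (2 : ℝ) ≤ n := by exact_mod_cast hn2
  have hnR1 : (1 : ℝ) ≤ n := by linarith
  have hkR1 : (1 : ℝ) ≤ k := by exact_mod_cast hk1
  have hnum : Lam (n ^ b) n d Δ * Phi k Δ d < (2 : ℝ) ^ (-(k : ℝ) / 2) := by
    by_contra hge
    push Not at hge
    -- `d ≤ ε (k + 1)`
    have hdk : (d : ℝ) ≤ ε * ((k : ℝ) + 1) := by
      have h1 : (d : ℝ) / ε ≤ k := (Nat.le_ceil _).trans (by exact_mod_cast hceil)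
      rw [div_le_iff₀ hε] at h1
      nlinarith
    -- `n + 1 ≤ 2^{6k}` (as `n + 1 ≤ 2^{K+1} ≤ 2^{6k}`)
    have hN : (n : ℝ) + 1 ≤ (2 : ℝ) ^ (6 * (k : ℝ)) := by
      have h1 : n + 1 ≤ 2 ^ (6 * k) :=
        (Nat.succ_le_of_lt hn2K).trans (Nat.pow_le_pow_right (by norm_num) (by omega))
      have h2 : ((n + 1 : ℕ) : ℝ) ≤ ((2 ^ (6 * k) : ℕ) : ℝ) := by exact_mod_cast h1
      rw [show (6 : ℝ) * (k : ℝ) = ((6 * k : ℕ) : ℝ) by push_cast; ring, Real.rpow_natCast]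
      push_cast at h2 ⊢
      exact h2
    -- `√n ≤ 2^k` (as `n < 2^{K+1} ≤ (2^k)^2`)
    have hsqrt : Real.sqrt n ≤ (2 : ℝ) ^ (k : ℝ) := by
      have h1 : n ≤ (2 ^ k) ^ 2 := by
        calc n ≤ 2 ^ (K + 1) := hn2K.le
          _ ≤ 2 ^ (2 * k) := Nat.pow_le_pow_right (by norm_num) (by omega)
          _ = (2 ^ k) ^ 2 := by rw [← pow_mul, mul_comm]
      have h2 : (n : ℝ) ≤ ((2 : ℝ) ^ (k : ℝ)) ^ 2 := by
        rw [Real.rpow_natCast]; exact_mod_cast h1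
      calc Real.sqrt n ≤ Real.sqrt (((2 : ℝ) ^ (k : ℝ)) ^ 2) := Real.sqrt_le_sqrt h2
        _ = (2 : ℝ) ^ (k : ℝ) := Real.sqrt_sq (by positivity)
    have hfin := H n d (n ^ b) n k hd₀d hdk h10 hk1 hN hsqrt hnR2 hge
    -- `n^{d^δ} ≥ n^{b+1} = n^b · n > n^b`
    have hge2 : (n : ℝ) ^ ((b : ℝ) + 1) ≤ (n : ℝ) ^ ((d : ℝ) ^ δ) :=
      Real.rpow_le_rpow_of_exponent_le hnR1 hbδ
    have heq : (n : ℝ) ^ ((b : ℝ) + 1) = (n : ℝ) ^ b * n := by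
      rw [Real.rpow_add (by linarith), Real.rpow_natCast, Real.rpow_one]
    have hcast : ((n ^ b : ℕ) : ℝ) = (n : ℝ) ^ b := by push_cast; ring
    rw [hcast] at hfin
    have hpos : (0 : ℝ) < (n : ℝ) ^ b := by positivity
    nlinarith
  exact not_isSuccinctHittingSet_productDepth k pos hd1 hdn h10 hover e hnum ha

/-- **The fan-in-two sub-slice of `SmallCircuits ℂ n b`.**  The same for the polynomials of
`SmallCircuits ℂ n b` that have a fan-in-two circuit of size `≤ n^b` AND product-depth `≤ Δ`
(a subclass of the class above, `IsSuccinctHittingSet.mono`). [cite: LimayeSrinivasanTavenas2025, Cor. 4] -/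
theorem naturalProofsAgainstProductDepth_smallCircuits (b Δ : ℕ) (hΔ : 1 ≤ Δ) :
    ∃ a n₀ : ℕ, ∀ n ≥ n₀, ¬ IsSuccinctHittingSet (degLEMonomials n)
      {f : MvPolynomial (Fin n) ℂ | f ∈ SmallCircuits ℂ n b ∧
        ∃ P : ArithCircuit ℂ (Fin n), P.IsFanInTwo ∧ P.Computes f ∧ P.size ≤ n ^ b ∧
          P.productDepth ≤ Δ}
      (Distinguishers ℂ n a) := by
  obtain ⟨a, n₀, h⟩ := naturalProofsAgainstProductDepth b Δ hΔ
  refine ⟨a, n₀, fun n hn hS => h n hn (hS.mono ?_ le_rfl)⟩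
  rintro f ⟨hf, P, -, hPf, hPs, hPΔ⟩
  exact ⟨hf.1, P, hPf, hPs, hPΔ⟩

/-- **The crux's `∀ b ∃ a` shape on the constant product-depth slice** (`q = 0` Boolean
variables): for every `b` and `Δ ≥ 1`, eventually in `n`, a datum `H` with `L(H), deg H ≤ N^a` and
`boolSum H ≠ 0` vanishing at `coeff(f)` for every `f` of degree `≤ n` with a product-depth-`Δ`
circuit of `≤ n^b` gates — the statement `SingleSizeEquations` asks for, with `SmallCircuits ℂ n b`
replaced by its constant-product-depth slice. [cite: LimayeSrinivasanTavenas2025, Cor. 4] -/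
theorem productDepthSliceEquations (b Δ : ℕ) (hΔ : 1 ≤ Δ) :
    ∃ a n₀ : ℕ, ∀ n ≥ n₀, ∃ q : ℕ, q ≤ Nat.choose (2 * n) n ^ a ∧
      ∃ H : MvPolynomial (↥(degLEMonomials n) ⊕ Fin q) ℂ,
        complexity H ≤ Nat.choose (2 * n) n ^ a ∧ H.totalDegree ≤ Nat.choose (2 * n) n ^ a ∧
        boolSum H ≠ 0 ∧
        ∀ f : MvPolynomial (Fin n) ℂ, f.totalDegree ≤ n →
          (∃ P : ArithCircuit ℂ (Fin n), P.Computes f ∧ P.size ≤ n ^ b ∧ P.productDepth ≤ Δ) →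
          eval (coeffVector (degLEMonomials n) f) (boolSum H) = 0 := by
  obtain ⟨a, n₀, h⟩ := naturalProofsAgainstProductDepth b Δ hΔ
  refine ⟨a, n₀, fun n hn => ?_⟩
  obtain ⟨D, hD, hD0, hvan⟩ := (exists_isNaturalProof_iff _ _ _).mpr (h n hn)
  -- `q = 0`: the empty Boolean sum of `rename inl D` is `D`
  have hbs : boolSum (m := 0) (MvPolynomial.rename Sum.inl D) = D := by
    rw [boolSum, Fintype.sum_unique, MvPolynomial.aeval_rename, Sum.elim_comp_inl,
      MvPolynomial.aeval_X_left, AlgHom.coe_id, id_eq]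
  refine ⟨0, Nat.zero_le _, MvPolynomial.rename Sum.inl D, ?_, ?_, ?_, fun f hf hP => ?_⟩
  · exact (complexity_rename_le_holds' _ _).trans hD.1
  · exact (MvPolynomial.totalDegree_rename_le _ _).trans hD.2
  · rwa [hbs]
  · rw [hbs]; exact hvan f ⟨hf, hP⟩

end LSTSlice

end Summit.ValiantsHypothesis.ValiantsHypothesis.Theorems.BarrierLeverDefinableEquations
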